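import Literature.NumberTheory.EllipticCurves.Rank1Residual.Typed.X2
import Literature.NumberTheory.EllipticCurves.Wuthrich2014.ReducibleMultiplicativeDivisibility
import HarnessLib

/-!
# Class X2 (odd multiplicative Eisenstein prime): the statement of record, its sub-cells, and the
# typed missing inputs (cell `b2b-bsdres`, unit `b2b-bsdres-eisenstein-p2`)

HONEST FRAMING (run/shared/lean/b2b/bsd-rank1-residual/, verbatim in every file): the goal of the
cell is to DELETE the COMBINATION-SHAPED residual classes of the Birch–Swinnerton-Dyer formula for
ALL analytic-rank `≤ 1` elliptic curves over `ℚ` — "full BSD formula for every rank `≤ 1` curve in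
class `C`" assembled STRICTLY from published theorems — so that the rank-`≤ 1` remainder becomes
exactly the CONSTRUCTION-SHAPED classes, which are TYPED (missing-input `Prop`s), NOT attempted.
This is not "finishing BSD". Research routes; no claim beyond stated classes.

**Class X2** (RESIDUAL-CASES.md §a.2 v3 = `Literature/…/Rank1Residual/Predicates.lean`,
`ClassX2 W p := p ≠ 2 ∧ Red W p ∧ Mult W p`): an odd prime `p ‖ N` at which `E[p]` is reducible
(`30a1, 51a1, 66a1, 84a1 @3`; `110a1@5`); both analytic ranks; census N < 10⁴: 843 pairs (776 at
`p = 3`). Label at input: CONSTRUCTION-SHAPED. PARTITION.md §3 row 8 (512 grid cells).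

This file holds DEFINITIONS and BOOKKEEPING only (no named fact, nothing asserted):

* `X2.Target` — the class statement of record: `∀ W p, r_an(W) ≤ 1 → ClassX2 W p → BSDp W p`
  (an OPEN statement; it is the conjunction of the three sub-cell targets below,
  `X2.target_of_targets` / `X2.targets_of_target`).
* The SUB-CELLS (a decidable case split of X2 by analytic rank and by the Greenberg–Vatsal parity
  predicate `GVPar W p` of `Predicates.lean` — "some rational `p`-isogeny kernel is ramified at `p`
  and even, or unramified at `p` and odd" —, exhaustive by `X2.cellA_or_cellB_or_cellC`):
  - `X2.CellA W p := r_an = 0 ∧ ClassX2 W p ∧ GVPar W p` — the Greenberg–Vatsal cell. Its target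
    `X2.TargetA` is PROVED from published named facts in `X2/RankZero.lean`
    (`X2.targetA_of_published`: Greenberg–Vatsal 2000 at a multiplicative prime + Greenberg 1999
    Prop. 5.10 + Wuthrich 2014 Thm. 16 ⇒ Mazur's main conjecture at `(E,p)`; + Stein–Wuthrich 2013
    Thm. 6.1, Greenberg–Stevens, Barré-Sirieix–Diaz–Gramain–Philibert, Gross–Zagier–Kolyvagin,
    modularity ⇒ `BSD(E,p)`), i.e. a candidate COVERED row "C7m" of the partition (the multiplicative
    twin of row C7 = GV-chain), subject to the referee's ruling on the flag `GV00-mult-asserted`.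
  - `X2.CellB W p := r_an = 0 ∧ ClassX2 W p ∧ ¬ GVPar W p` — the other parity type (`μ^alg > 0`
    or a rational `p`-torsion point in the isogeny class: Greenberg–Vatsal result B / `X₀(11)` at
    `5`). Typed missing input: Mazur's main conjecture at `(E, p)` (`X2.MazurMainConjectureAt`);
    nothing in print or announced reaches it (Keller–Yin arXiv:2402.12781 Thm. 4 is the
    ANTICYCLOTOMIC main conjecture at `p ‖ N`, PRE). CONSTRUCTION-SHAPED.
  - `X2.CellC W p := r_an = 1 ∧ ClassX2 W p` — rank one. Typed missing input: the `p`-part output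
    `Typed.MissingPPartAt W p` (anticyclotomic control + Heegner-point main conjecture at `p ‖ N`
    for reducible `E[p]`; Keller–Yin Thm. 4 gives the IMC in `Λ^ur`, PRE, and the authors state the
    BSD formula only "provided the results in [CGS] are extended"). CONSTRUCTION-SHAPED.
* `X2.MazurMainConjectureAt W p` — the TYPE of the rank-`0` missing input: for the cyclotomic data,
  every newform `f` of `W`, every `ϖ` with `ϖ·Ω_E = Ω⁺_f` and every dual datum `D` of
  `Sel_{p^∞}(E/ℚ_∞)`: `X` is torsion, `char_Λ X = (g)`, and `ι(T·g·w) = ϖ·L` (split) /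
  `ι(g·w) = ϖ·L` (non-split) for a unit `w`, `L` THE Mazur–Tate–Teitelbaum function — literally the
  conclusion shape of `Skinner2016.thmA_charIdeal_multiplicative` (which needs `E[p]` irreducible
  and (ram)) and the hypothesis `hMC` of `Rank1Residual.Typed.bsdp_of_multCharIdeal_{split,nonsplit}_rankZero`.
  `X2/RankZero.lean` proves `CellA ⇒ MazurMainConjectureAt` (from the published facts) and
  `r_an = 0 ∧ Mult ∧ MazurMainConjectureAt ⇒ BSDp` (for ALL of X2's rank-`0` half, both parities).

References: RESIDUAL-CASES.md §a.2 row X2; HOME/b2b-bsdres-eisenstein-p2/X2-GAP.md; R. Greenberg,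
V. Vatsal, Invent. Math. 142 (2000); R. Greenberg, LNM 1716 (1999) Prop. 5.10; C. Wuthrich, Doc.
Math. 19 (2014) Thm. 16; C. Skinner, Pacific J. Math. 283 (2016) Thm. A; T. Keller, M. Yin,
arXiv:2402.12781v2 Thm. 4 (PRE); R. L. Miller, LMS J. Comput. Math. 14 (2011) Def. 1.1 (`BSDp`).
-/

set_option autoImplicit false

noncomputable section

open scoped Classical MatrixGroups ModularForm

open CongruenceSubgroup WeierstrassCurve Literature.NumberTheory.EllipticCurves
  Literature.NumberTheory.EllipticCurves.ModularForms
  Literature.NumberTheory.EllipticCurves.Rank1Residual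
  Literature.NumberTheory.EllipticCurves.Rank1Residual.Typed

namespace Summit.BirchSwinnertonDyer.Rank1Residual.X2

/-! ### The statement of record -/

/-- **Class theorem of record for X2** (OPEN; CONSTRUCTION-SHAPED): for every elliptic curve
`E/ℚ` (globally minimal model `W`) with `ord_{s=1} L(E,s) ≤ 1` and every prime `p` with
`(E,p) ∈ X2` (`p` odd, `E[p]` reducible, `p ‖ N`), Miller's `BSD(E,p)`. A `Prop`; nothing asserted
(bookkeeping over the cell's predicates; RESIDUAL-CASES.md §a.2 row X2). [folklore] -/
def Target : Prop :=
  ∀ (W : WeierstrassCurve ℚ) [W.IsElliptic] [W.IsGloballyMinimal] (p : ℕ) [Fact p.Prime],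
    W.analyticRank ≤ 1 → ClassX2 W p → BSDp W p

/-! ### The sub-cells -/

section Cells

variable (W : WeierstrassCurve ℚ) (p : ℕ) [Fact p.Prime]

/-- **Sub-cell X2a** (Greenberg–Vatsal cell): analytic rank `0`, `(E,p) ∈ X2`, and (GV) — some
rational `p`-isogeny kernel is ramified-at-`p`-and-even or unramified-at-`p`-and-odd (the hypothesis of
Greenberg–Vatsal 2000 Thm. (1.3) / Greenberg 1999 Prop. 5.10, tree predicate `GVPar`). [folklore] -/
def CellA : Prop := W.analyticRank = 0 ∧ ClassX2 W p ∧ GVPar W p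

/-- **Sub-cell X2b**: analytic rank `0`, `(E,p) ∈ X2`, and NOT (GV) (every rational `p`-isogeny
kernel is ramified-odd or unramified-even; e.g. a rational `p`-torsion point in the class). [folklore] -/
def CellB : Prop := W.analyticRank = 0 ∧ ClassX2 W p ∧ ¬ GVPar W p

/-- **Sub-cell X2c**: analytic rank `1`, `(E,p) ∈ X2`. [folklore] -/
def CellC : Prop := W.analyticRank = 1 ∧ ClassX2 W p

/-- The three sub-cells exhaust X2 in analytic rank `≤ 1` (excluded middle on `GVPar`). [folklore] -/
theorem cellA_or_cellB_or_cellC (hr : W.analyticRank ≤ 1) (hX : ClassX2 W p) :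
    CellA W p ∨ CellB W p ∨ CellC W p := by
  rcases Nat.le_one_iff_eq_zero_or_eq_one.mp hr with h0 | h1
  · by_cases hpar : GVPar W p
    · exact Or.inl ⟨h0, hX, hpar⟩
    · exact Or.inr (Or.inl ⟨h0, hX, hpar⟩)
  · exact Or.inr (Or.inr ⟨h1, hX⟩)

/-- The sub-cells are pairwise disjoint (bookkeeping). [folklore] -/
theorem cells_disjoint :
    ¬ (CellA W p ∧ CellB W p) ∧ ¬ (CellA W p ∧ CellC W p) ∧ ¬ (CellB W p ∧ CellC W p) := by
  refine ⟨fun ⟨hA, hB⟩ => hB.2.2 hA.2.2, fun ⟨hA, hC⟩ => ?_, fun ⟨hB, hC⟩ => ?_⟩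
  · have := hA.1; have := hC.1; omega
  · have := hB.1; have := hC.1; omega

end Cells

/-- Target of sub-cell X2a: `BSD(E,p)` on every `CellA` pair. PROVED from published named facts in
`X2/RankZero.lean` (`targetA_of_published`). A `Prop`; nothing asserted. [folklore] -/
def TargetA : Prop :=
  ∀ (W : WeierstrassCurve ℚ) [W.IsElliptic] [W.IsGloballyMinimal] (p : ℕ) [Fact p.Prime],
    CellA W p → BSDp W p

/-- Target of sub-cell X2b (OPEN, CONSTRUCTION-SHAPED): `BSD(E,p)` on every `CellB` pair. A `Prop`;
nothing asserted. [folklore] -/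
def TargetB : Prop :=
  ∀ (W : WeierstrassCurve ℚ) [W.IsElliptic] [W.IsGloballyMinimal] (p : ℕ) [Fact p.Prime],
    CellB W p → BSDp W p

/-- Target of sub-cell X2c (OPEN, CONSTRUCTION-SHAPED): `BSD(E,p)` on every `CellC` pair. A `Prop`;
nothing asserted. [folklore] -/
def TargetC : Prop :=
  ∀ (W : WeierstrassCurve ℚ) [W.IsElliptic] [W.IsGloballyMinimal] (p : ℕ) [Fact p.Prime],
    CellC W p → BSDp W p

/-- **Assembly**: the three sub-cell targets give the class theorem of record. [folklore] -/
theorem target_of_targets (hA : TargetA) (hB : TargetB) (hC : TargetC) : Target := by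
  intro W _ _ p _ hr hX
  rcases cellA_or_cellB_or_cellC W p hr hX with h | h | h
  · exact hA W p h
  · exact hB W p h
  · exact hC W p h

/-- Conversely the class theorem of record gives each sub-cell target (so the split loses nothing).
[folklore] -/
theorem targets_of_target (h : Target) : TargetA ∧ TargetB ∧ TargetC :=
  ⟨fun W _ _ p _ hc => h W p (by rw [hc.1]; omega) hc.2.1,
   fun W _ _ p _ hc => h W p (by rw [hc.1]; omega) hc.2.1,
   fun W _ _ p _ hc => h W p (by rw [hc.1]) hc.2⟩

/-! ### The typed missing input of the rank-`0` half: Mazur's main conjecture at `(E, p)` -/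

/-- **Mazur's main conjecture at a multiplicative prime `p` for `E`, in the Néron normalisation and
with the trivial zero** (a `Prop` on `(W, p)`; nothing asserted): for the cyclotomic `ℤ_p`-extension
`κ` with topological generator `γ` matching the cyclotomic variable `T`, every newform `f` of `W`,
every `ϖ ∈ ℚ` with `ϖ · Ω_E = Ω⁺_f`, and every Pontryagin-dual datum `D` of `Sel_{p^∞}(E/ℚ_∞)`:
`X(E/ℚ_∞)` is `Λ`-torsion and `char_Λ X = (g)` with, for a unit `w ∈ Λˣ`, `ι(T · g · w) = ϖ · L` for
THE split-multiplicative Mazur–Tate–Teitelbaum function `L` if `p` is split, and `ι(g · w) = ϖ · L`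
for THE non-split one otherwise — verbatim the conclusion of `Skinner2016.thmA_charIdeal_multiplicative`
(Skinner, Pacific J. Math. 283 (2016) Thm. A with §3.2–3.3, printed under (irr) + (ram)) and the
hypothesis `hMC` of `Rank1Residual.Typed.bsdp_of_multCharIdeal_{split,nonsplit}_rankZero`. This is
the missing input of sub-cell X2b; on sub-cell X2a it is a theorem (`X2/RankZero.lean`).
[cite: Skinner2016PacificMC, Thm. A (§1) with §3.2–3.3 (shape only; nothing asserted)]
[cite: MazurTateTeitelbaum1986, §I.14 (shape only; nothing asserted)] -/
def MazurMainConjectureAt (W : WeierstrassCurve ℚ) [W.IsElliptic] [W.IsGloballyMinimal] (p : ℕ)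
    [Fact p.Prime] : Prop :=
  ∀ (κ : ZpExtension ℚ p) (γ : Field.absoluteGaloisGroup ℚ),
      κ.IsCyclotomic → κ.IsTopGenerator γ → IsCyclotomicVariable p γ →
    ∀ {N : ℕ} [NeZero N] (f : CuspForm (Gamma0 N) 2), IsNewformOf W f →
    ∀ (D : W.SelmerDualData κ γ) (ϖ : ℚ), (ϖ : ℝ) * W.realPeriodRat = plusPeriod f →
      D.IsTorsion ∧ ∃ g : IwasawaAlgebra p, D.charIdeal = Ideal.span {g} ∧
        (W.HasSplitMultiplicativeReductionAtPrime p →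
          ∀ L : PowerSeries ℚ_[p], IsSplitMultPAdicLFunctionOf f p L →
            ∃ w : (IwasawaAlgebra p)ˣ,
              iwasawaToPowerSeries p ((PowerSeries.X : IwasawaAlgebra p) * g * (w : IwasawaAlgebra p)) =
                PowerSeries.C ((ϖ : ℚ) : ℚ_[p]) * L) ∧
        (¬ W.HasSplitMultiplicativeReductionAtPrime p →
          ∀ L : PowerSeries ℚ_[p], IsMultPAdicLFunctionOf f p (-1) L →
            ∃ w : (IwasawaAlgebra p)ˣ,
              iwasawaToPowerSeries p (g * (w : IwasawaAlgebra p)) = PowerSeries.C ((ϖ : ℚ) : ℚ_[p]) * L)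

/-- **The typed missing input of sub-cell X2b** (rank `0`, other parity): Mazur's main conjecture at
the pair. Nothing in print or announced supplies it at a multiplicative Eisenstein prime of this
parity type (`μ^alg > 0` expected: Greenberg–Vatsal result B). A `Prop`; nothing asserted. [folklore] -/
def MissingInputB (W : WeierstrassCurve ℚ) [W.IsElliptic] [W.IsGloballyMinimal] (p : ℕ)
    [Fact p.Prime] : Prop :=
  MazurMainConjectureAt W p

/-- **The typed missing input of sub-cell X2c** (rank `1`): the `p`-part output
`Typed.MissingPPartAt W p` (anticyclotomic control with torsion + Heegner-point main conjecture at
`p ‖ N` for reducible `E[p]`; Keller–Yin 2024 Thm. 4 = the IMC only, PRE) — the rank-one clause of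
the cell's `Typed.X2.MissingInputAt`. A `Prop`; nothing asserted. [folklore] -/
def MissingInputC (W : WeierstrassCurve ℚ) (p : ℕ) : Prop :=
  MissingPPartAt W p

/-- Sub-cell X2c's target from its typed input and Gross–Zagier–Kolyvagin (`hGZK`, bsd.S17), by the
cell's bridge `Typed.bsdp_of_missingPPartAt`. [cite: Miller2011LMS, Def. 1.1] -/
theorem targetC_of_missingInputC (hGZK : rank_eq_analyticRank_of_analyticRank_le_one)
    (hmiss : ∀ (W : WeierstrassCurve ℚ) [W.IsElliptic] [W.IsGloballyMinimal] (p : ℕ) [Fact p.Prime],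
      CellC W p → MissingInputC W p) : TargetC := by
  intro W _ _ p _ hc
  exact bsdp_of_missingPPartAt W p hGZK (by rw [hc.1]) (hmiss W p hc)

/-- The cell's earlier typed input `Typed.X2.MissingInputAt` (Wuthrich lower bound in rank `0`,
`MissingPPartAt` in rank `1`) supplies `MissingInputC` on sub-cell X2c (consistency of the typings).
[folklore] -/
theorem missingInputC_of_missingInputAt (W : WeierstrassCurve ℚ) (p : ℕ) [Fact p.Prime] (hc : CellC W p) (h : X2.MissingInputAt W p) : MissingInputC W p :=
  h.2 hc.1

end Summit.BirchSwinnertonDyer.Rank1Residual.X2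

end
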